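import Summits.BirchSwinnertonDyer.BirchSwinnertonDyer.Theorems.PublishedInputsGreenbergLemma34WeilScalar
import Literature.NumberTheory.EllipticCurves.OrdinaryLocalKummerCountProofs
import HarnessLib

set_option linter.dupNamespace false -- `…BirchSwinnertonDyer.BirchSwinnertonDyer…` is the cell's nested layout (D-0017)
set_option autoImplicit false

/-!
# Greenberg LNM 1716 Lemma 3.4 at `n = 0`, step 5: `#(Ê[p^k])^τ = #(Ẽ-side τ-fixed reductions)[p^k]`
# (the two factors `|ker(a_v)|` and `|ker(d_v)|` of `|ker(r_v)|` are EQUAL at every depth)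

Seat `bsd-inputs-k4-p1` (gen 5; LADDER-BSD D-0154 KEY (147)(f) «prove the printed input», row 1 K4 INPUTS; Greenberg
1999), `--supports stmt-BirchSwinnertonDyer-20309`. THEOREMS ONLY (no definition, no named fact, no `sorry`).

R. Greenberg, *Iwasawa theory for elliptic curves*, LNM 1716 (1999), §3 Lemma 3.4 (pp. 89–90): both factors of
`|ker(r_v)| = |ker(a_v)| · |ker(d_v)|` equal `|Ẽ(f)_p|`; p. 79: `ψφ = χ`, so a Frobenius `τ` fixing `μ_{p^∞}`
(`χ(τ) = 1`) acts on `C = Ê[p^∞]` by `ψ(τ) = φ(τ)⁻¹`, and `(b − 1)x = 0` has as many solutions as `(b⁻¹ − 1)x = 0`. In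
the tree's abstract `red₀`-currency (`C_k = ker red₀ ∩ E[p^k]` cyclic on `P_k`, `τ P_k = b P_k`, `red₀(E[p^k]) = B[p^k]`):
for `y = red₀ Q` with `Q ∈ E[p^k]`, the Weil identity `b τQ − Q ∈ ℕP_k` (`localPoints_exists_nsmul_smul_sub_eq_nsmul`)
gives `b · red₀(τQ) = y`, so `red₀(τQ) = y ⟺ b y = y` (`p ∤ b`); and on both sides `{x : (b − 1)x = 0, p^k x = 0}` is
the `p^j`-torsion, `p^j = gcd(b − 1, p^k)`, of order `p^j` (`#C_j = p^j`, `#B[p^j] = p^j`).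

* `natCard_fixed_formalTorsion_eq_natCard_fixed_reduction` — **`#{c ∈ C_k : τ c = c} = #{y ∈ B : p^k y = 0, y a
  τ-fixed reduction}`**, a `τ`-fixed reduction being `y = red₀ Q` with `red₀ (τ Q) = y` (independent of the lift `Q`).

HONEST FRAMING: a local TOOL theorem with displayed hypotheses; closes nothing; no summit statement is proved; BSD is
not proved by any of this.

References: [GreenbergLNM1716] §2 p. 79, §3 Lemma 3.4 (pp. 89–90); [SilvermanAEC2009] Prop. III.8.1.
-/

noncomputable section

open scoped Classical AddSubgroup

universe u v

namespace Summit.BirchSwinnertonDyer.BirchSwinnertonDyer.Theorems.InputsGreenbergLemma34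

open Field Literature.NumberTheory.EllipticCurves Literature.NumberTheory.GaloisRepresentations WeierstrassCurve

variable {K : Type u} [Field K] (W : WeierstrassCurve K) [W.IsElliptic]
  (E : Type u) [Field E] [Algebra K E] [CharZero E] {p : ℕ} [hp : Fact p.Prime]

/-- Bookkeeping (Bézout): for `z` killed by `n`, `d • z = 0 ↔ gcd(d, n) • z = 0`. [folklore] -/
private theorem zsmul_eq_zero_iff_gcd_nsmul_eq_zero {A : Type*} [AddCommGroup A] (d : ℤ) (n : ℕ) (z : A)
    (hz : n • z = 0) : d • z = 0 ↔ Int.gcd d n • z = 0 := by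
  constructor
  · intro hd
    have h := Int.gcd_eq_gcd_ab d n
    rw [← natCast_zsmul, h, add_smul, mul_comm d, mul_smul, hd, smul_zero, zero_add, mul_comm, mul_smul,
      natCast_zsmul, hz, smul_zero]
  · intro hg
    obtain ⟨c, hc⟩ := Int.gcd_dvd_left d n
    rw [hc, mul_comm, mul_smul, natCast_zsmul, hg, smul_zero]

set_option maxHeartbeats 1600000 in
/-- **`#{c ∈ C_k : τ c = c} = #{y ∈ B[p^k] : y a τ-fixed reduction}`** — the two factors of Greenberg's
`|ker(r_v)| = |Ẽ(f)_p|²` agree at every depth. Setting: `E` a field of characteristic `0` over `K`, `W/K` elliptic,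
`red₀ : E(K̄_E) → B` additive with `Γ_E`-stable kernel (`hstab`), `ker red₀ ∩ E[p^r]` cyclic of order `p^r` on a
generator (`hgenr`) and `red₀(E[p^r]) = B[p^r]` (`hsurj`), `τ ∈ Γ_E` fixing every `p`-power root of unity, and
`C = ker red₀ ∩ E(K̄_E)[p^k]`. A `τ`-FIXED REDUCTION is a `y = red₀ Q` with `red₀ (τ Q) = y`. See the module
docstring for the proof (Weil identity for `τ`, `ψ(τ)φ(τ) = 1`; both sides are the `gcd(ψ(τ) − 1, p^k)`-torsion).
[cite: GreenbergLNM1716, §2 p. 79 and §3 Lemma 3.4 (pp. 89–90)] [cite: SilvermanAEC2009, Prop. III.8.1] -/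
theorem natCard_fixed_formalTorsion_eq_natCard_fixed_reduction {B : Type v} [AddCommGroup B]
    (red₀ : localPoints W E →+ B)
    (hstab : ∀ (σ : absoluteGaloisGroup E) (Q : localPoints W E), red₀ Q = 0 → red₀ (σ • Q) = 0)
    (hgenr : ∀ r : ℕ, ∃ P₁ : localPoints W E, red₀ P₁ = 0 ∧ addOrderOf P₁ = p ^ r ∧
      ∀ P : localPoints W E, red₀ P = 0 → ((p ^ r : ℕ) : ℤ) • P = 0 → ∃ c : ℕ, P = c • P₁)
    (hsurj : ∀ (r : ℕ) (y : B), ((p ^ r : ℕ) : ℤ) • y = 0 →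
      ∃ x : localPoints W E, ((p ^ r : ℕ) : ℤ) • x = 0 ∧ red₀ x = y)
    {τ : absoluteGaloisGroup E} (hτfix : ∀ (r : ℕ) (ξ : AlgebraicClosure E), ξ ^ p ^ r = 1 → τ • ξ = ξ)
    (k : ℕ) (C : AddSubgroup (localPoints W E)) (hC : ∀ a, a ∈ C ↔ red₀ a = 0 ∧ p ^ k • a = 0) :
    Nat.card {c : C // τ • (c : localPoints W E) = c} =
      Nat.card {y : B // ((p ^ k : ℕ) : ℤ) • y = 0 ∧ ∃ Q : localPoints W E, red₀ Q = y ∧ red₀ (τ • Q) = y} := by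
  -- notation
  let P : Type u := localPoints W E
  let Γ := absoluteGaloisGroup E
  have hpr : ∀ r : ℕ, p ^ r ≠ 0 := fun r ↦ pow_ne_zero r hp.out.ne_zero
  have galois_smul_nsmul : ∀ (σ : Γ) (n : ℕ) (Q : P), σ • (n • Q) = n • (σ • Q) :=
    fun σ n Q ↦ map_nsmul (DistribSMul.toAddMonoidHom P σ) n Q
  -- the subgroups `C_r = ker red₀ ∩ E[p^r]`, of order `p^r`
  let Cr : ℕ → AddSubgroup P := fun r ↦ red₀.ker ⊓ AddSubgroup.torsionBy P ((p ^ r : ℕ) : ℤ)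
  have hmemC : ∀ (r : ℕ) (Q : P), Q ∈ Cr r ↔ red₀ Q = 0 ∧ ((p ^ r : ℕ) : ℤ) • Q = 0 := fun r Q ↦ by
    change Q ∈ red₀.ker ⊓ AddSubgroup.torsionBy P ((p ^ r : ℕ) : ℤ) ↔ _
    rw [AddSubgroup.mem_inf, AddMonoidHom.mem_ker, mem_torsionBy_iff]
  have hcardC : ∀ r : ℕ, Nat.card (Cr r) = p ^ r := by
    intro r
    obtain ⟨P₁, hP₁, hord₁, hgen₁⟩ := hgenr r
    have hP₁C : P₁ ∈ Cr r := (hmemC r P₁).mpr ⟨hP₁, by rw [natCast_zsmul, ← hord₁, addOrderOf_nsmul_eq_zero]⟩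
    have hCeq : Cr r = AddSubgroup.zmultiples P₁ := by
      refine le_antisymm ?_ (AddSubgroup.zmultiples_le.mpr hP₁C)
      intro Q hQ
      obtain ⟨c, rfl⟩ := hgen₁ Q ((hmemC r Q).mp hQ).1 ((hmemC r Q).mp hQ).2
      exact AddSubgroup.mem_zmultiples_iff.mpr ⟨c, natCast_zsmul P₁ c⟩
    rw [hCeq, Nat.card_zmultiples, hord₁]
  -- `#B[p^r] = p^r`
  have hBcard : ∀ r : ℕ, Nat.card (B[(p ^ r : ℕ)]) = p ^ r := by
    intro r
    have hsurj' : ∀ y ∈ B[(p ^ r : ℕ)], ∃ x ∈ (localPoints W E)[(p ^ r : ℕ)], red₀ x = y := by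
      intro y hy
      obtain ⟨x, hx, hxy⟩ := hsurj r y (mem_torsionBy_iff.mp hy)
      exact ⟨x, mem_torsionBy_iff.mpr hx, hxy⟩
    have hmul := TateModule.card_ker_torsionBy_mul_card red₀ (p ^ r) hsurj'
    have hA : Nat.card ((localPoints W E)[(p ^ r : ℕ)]) = p ^ r * p ^ r := by
      haveI : PerfectField E := PerfectField.ofCharZero
      have h := card_torsionBy_eq_sq (E := W.baseChange (AlgebraicClosure E)) (n := p ^ r)
        (by exact_mod_cast hpr r)
      rw [sq] at h
      exact h
    have hker : Nat.card ((red₀.ker)[(p ^ r : ℕ)]) = p ^ r := by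
      refine Eq.trans (Nat.card_congr (⟨fun x ↦ ⟨((x : red₀.ker) : P),
        (hmemC r _).mpr ⟨(x : red₀.ker).2, ?_⟩⟩, fun y ↦ ⟨⟨(y : P), ((hmemC r _).mp y.2).1⟩, ?_⟩,
        fun x ↦ rfl, fun y ↦ rfl⟩ : (red₀.ker)[(p ^ r : ℕ)] ≃ Cr r)) (hcardC r)
      · exact congrArg Subtype.val (mem_torsionBy_iff.mp x.2)
      · rw [mem_torsionBy_iff]
        apply Subtype.ext
        exact ((hmemC r _).mp y.2).2
    rw [hker, hA] at hmul
    exact Nat.eq_of_mul_eq_mul_left (Nat.pos_of_ne_zero (hpr r)) hmul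
  -- the generator `P_k` of `C` and the scalar `b` of `τ` on it
  obtain ⟨Pk, hPk0, hPkord, hPkgen⟩ := hgenr k
  have hPkp : p ^ k • Pk = 0 := by rw [← hPkord]; exact addOrderOf_nsmul_eq_zero Pk
  have hPkp' : ((p ^ k : ℕ) : ℤ) • Pk = 0 := by rw [natCast_zsmul]; exact hPkp
  obtain ⟨b, hb⟩ : ∃ b : ℕ, τ • Pk = b • Pk :=
    hPkgen (τ • Pk) (hstab τ Pk hPk0) (by rw [natCast_zsmul, ← galois_smul_nsmul, hPkp, smul_zero])
  have hmul : ∀ a ∈ C, ∃ c : ℕ, a = c • Pk := fun a ha ↦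
    hPkgen a ((hC a).mp ha).1 (by rw [natCast_zsmul]; exact ((hC a).mp ha).2)
  have hτc : ∀ c : C, τ • (c : P) = b • (c : P) := fun c ↦ by
    obtain ⟨i, hi⟩ := hmul c c.2
    rw [hi, galois_smul_nsmul, hb, smul_smul, smul_smul, mul_comm]
  -- `p ∤ b` (for `k ≥ 1`): otherwise `τ P_k` would be killed by `p^{k-1}`
  have hbcop : 0 < k → Nat.Coprime b (p ^ k) := by
    intro hk
    refine Nat.Coprime.pow_right _ ((Nat.coprime_comm.mp ((Nat.Prime.coprime_iff_not_dvd hp.out).mpr ?_)))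
    rintro ⟨m, rfl⟩
    have h1 : p ^ (k - 1) • (τ • Pk) = 0 := by
      rw [hb, smul_smul, show p ^ (k - 1) * (p * m) = m * p ^ k by
        rw [← mul_assoc, ← pow_succ, Nat.sub_add_cancel hk, mul_comm], mul_smul, hPkp, smul_zero]
    rw [← galois_smul_nsmul] at h1
    have h2 : p ^ (k - 1) • Pk = 0 := (smul_eq_zero_iff_eq τ).mp h1
    have h3 : p ^ k ∣ p ^ (k - 1) := by rw [← hPkord]; exact addOrderOf_dvd_of_nsmul_eq_zero h2
    exact absurd (Nat.le_of_dvd (pow_pos hp.out.pos _) h3)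
      (not_le.mpr (Nat.pow_lt_pow_right hp.out.one_lt (Nat.sub_lt hk one_pos)))
  -- `d = b − 1` and `g = gcd(d, p^k) = p^j`
  set d : ℤ := (b : ℤ) - 1 with hd
  set g : ℕ := Int.gcd d (p ^ k : ℕ) with hg
  have hgdvd : g ∣ p ^ k := by
    have h : (Int.gcd d (p ^ k : ℕ) : ℤ) ∣ ((p ^ k : ℕ) : ℤ) := Int.gcd_dvd_right d (p ^ k : ℕ)
    exact_mod_cast h
  obtain ⟨j, hjk, hgj⟩ := (Nat.dvd_prime_pow hp.out).mp hgdvd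
  -- `b x = x ↔ d x = 0 ↔ p^j x = 0` for `x` killed by `p^k`
  have hkey : ∀ {A : Type v} [AddCommGroup A] (x : A), ((p ^ k : ℕ) : ℤ) • x = 0 →
      (b • x = x ↔ ((p ^ j : ℕ) : ℤ) • x = 0) := by
    intro A _ x hx
    rw [natCast_zsmul] at hx
    rw [natCast_zsmul, ← hgj, hg, ← zsmul_eq_zero_iff_gcd_nsmul_eq_zero d (p ^ k) x hx, hd, sub_smul, one_smul,
      natCast_zsmul, sub_eq_zero]
  have hkeyP : ∀ (x : P), ((p ^ k : ℕ) : ℤ) • x = 0 → (b • x = x ↔ ((p ^ j : ℕ) : ℤ) • x = 0) := by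
    intro x hx
    rw [natCast_zsmul] at hx
    rw [natCast_zsmul, ← hgj, hg, ← zsmul_eq_zero_iff_gcd_nsmul_eq_zero d (p ^ k) x hx, hd, sub_smul, one_smul,
      natCast_zsmul, sub_eq_zero]
  -- the `C`-side: `{c ∈ C : τ c = c} ≃ C_j`
  have hjk' : ∀ x : P, ((p ^ j : ℕ) : ℤ) • x = 0 → ((p ^ k : ℕ) : ℤ) • x = 0 := fun x hx ↦ by
    obtain ⟨e, he⟩ := Nat.exists_eq_add_of_le hjk
    rw [he, pow_add, Nat.cast_mul, mul_comm, mul_smul, hx, smul_zero]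
  have hCside : Nat.card {c : C // τ • (c : P) = c} = p ^ j := by
    rw [← hcardC j]
    refine Nat.card_congr ?_
    exact
      { toFun := fun c ↦ ⟨((c.1 : C) : P), (hmemC j _).mpr ⟨((hC _).mp c.1.2).1,
          (hkeyP _ (by rw [natCast_zsmul]; exact ((hC _).mp c.1.2).2)).mp (by rw [← hτc]; exact c.2)⟩⟩
        invFun := fun y ↦
          have hyC : (y : P) ∈ C := (hC _).mpr ⟨((hmemC j _).mp y.2).1, by
            have h := hjk' _ ((hmemC j _).mp y.2).2
            rwa [natCast_zsmul] at h⟩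
          ⟨⟨(y : P), hyC⟩, by
            change τ • (y : P) = (y : P)
            rw [hτc ⟨(y : P), hyC⟩]
            exact (hkeyP _ (hjk' _ ((hmemC j _).mp y.2).2)).mpr ((hmemC j _).mp y.2).2⟩
        left_inv := fun c ↦ Subtype.ext (Subtype.ext rfl)
        right_inv := fun y ↦ Subtype.ext rfl }
  -- the `B`-side: a `τ`-fixed reduction `y ∈ B[p^k]` is one with `b y = y`
  have hBfix : ∀ y : B, ((p ^ k : ℕ) : ℤ) • y = 0 →
      ((∃ Q : P, red₀ Q = y ∧ red₀ (τ • Q) = y) ↔ b • y = y) := by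
    intro y hy
    -- a `p^k`-torsion lift `Q` of `y`, and the Weil identity `b red₀(τQ) = y`
    obtain ⟨Q, hQ, hQy⟩ := hsurj k y hy
    obtain ⟨e, he⟩ := W.localPoints_exists_nsmul_smul_sub_eq_nsmul E hPkord (hτfix k) hb Q hQ
    have hW : b • red₀ (τ • Q) = y := by
      have h := congrArg red₀ he
      rw [map_sub, map_nsmul, map_nsmul, hPk0, smul_zero, sub_eq_zero, hQy] at h
      exact h
    constructor
    · rintro ⟨Q', hQ'y, hQ'⟩
      -- `τ`-fixedness does not depend on the lift
      have h0 : red₀ (Q' - Q) = 0 := by rw [map_sub, hQ'y, hQy, sub_self]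
      have h1 : red₀ (τ • (Q' - Q)) = 0 := hstab τ _ h0
      rw [smul_sub, map_sub, hQ', sub_eq_zero] at h1
      rw [← h1] at hW
      exact hW
    · intro hby
      refine ⟨Q, hQy, ?_⟩
      -- `b (red₀ τQ − y) = 0` and `p^k (red₀ τQ − y) = 0`, `p ∤ b`
      rcases Nat.eq_zero_or_pos k with hk0 | hkpos
      · -- `k = 0`: `y = 0` and `Q = 0`
        rw [hk0, pow_zero, Nat.cast_one, one_smul] at hQ
        rw [hQ, smul_zero, map_zero, ← hQy, hQ, map_zero]
      have hz : b • (red₀ (τ • Q) - y) = 0 := by rw [smul_sub, hW, hby, sub_self]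
      have hzp : p ^ k • (red₀ (τ • Q) - y) = 0 := by
        rw [smul_sub, ← map_nsmul, ← galois_smul_nsmul, ← natCast_zsmul, hQ, smul_zero, map_zero, ← natCast_zsmul,
          hy, sub_self]
      have hord : addOrderOf (red₀ (τ • Q) - y) ∣ Nat.gcd b (p ^ k) :=
        Nat.dvd_gcd (addOrderOf_dvd_of_nsmul_eq_zero hz) (addOrderOf_dvd_of_nsmul_eq_zero hzp)
      rw [hbcop hkpos, Nat.dvd_one, AddMonoid.addOrderOf_eq_one_iff] at hord
      exact sub_eq_zero.mp hord
  have hBside : Nat.card {y : B // ((p ^ k : ℕ) : ℤ) • y = 0 ∧ ∃ Q : P, red₀ Q = y ∧ red₀ (τ • Q) = y} = p ^ j := by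
    rw [← hBcard j]
    refine Nat.card_congr (Equiv.subtypeEquivRight fun y ↦ ?_)
    rw [mem_torsionBy_iff]
    constructor
    · rintro ⟨hy, hfix⟩
      exact (hkey y hy).mp ((hBfix y hy).mp hfix)
    · intro hy
      have hyk : ((p ^ k : ℕ) : ℤ) • y = 0 := by
        obtain ⟨e, he⟩ := Nat.exists_eq_add_of_le hjk
        rw [he, pow_add, Nat.cast_mul, mul_comm, mul_smul, hy, smul_zero]
      exact ⟨hyk, (hBfix y hyk).mpr ((hkey y hyk).mpr hy)⟩
  rw [hCside, hBside]

end Summit.BirchSwinnertonDyer.BirchSwinnertonDyer.Theorems.InputsGreenbergLemma34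

end
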